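import Summits.KontsevichZagierPeriods.KontsevichZagierPeriods.Theorems.RootDecompQuadraticDescentPair18HomotopyGridP3

/-! # `RootDecompQuadraticDescentPair18HomotopyGridP4` — part 4/5 of the mechanical ≤400-line split of `Grid_landing.lean` (sha256 c1ef4f0ae5c58233…)
Source: decomp-kz lens-6 g10 `Pair18HomotopyGrid.lean` (file #4; HOME/decomp-kz-lens-6/g10/, sha256 f97d8f44…; critic g5-19 CLEARED «census pair #18 = THEOREM, no hypothesis left»): hGrid_of_charts (hTh7) (hB17) : 4•[B11] − [Th7] − [B17] − 2•[PB7] ∈ KZ.relations — the nine-cell W₇-chart scissors congruence (7 cuts, 4 swaps, 4 inversions x ↦ 1/(7x) via W7_invert, linear cov); landed by census-1 g9 over the landed files #1/#2/#3 (copied prelude dropped, homonyms suffixed G, pins removed).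
Split by census-1 g9 `gen/splitlean.py`: scopes re-opened with their `open`/`variable`/`set_option` context; mathematics and declaration order unchanged. -/

set_option linter.unusedSimpArgs false
noncomputable section
open _root_.Set MvPolynomial
namespace Summit.KontsevichZagierPeriods.RootDecompQuadraticDescent.Pair18Homotopy
open Literature.NumberTheory.Transcendental
open Literature.NumberTheory.Transcendental.KZ (RFun cube)
open Summit.KontsevichZagierPeriods.RootDecompQuadraticDescent.DarkPairs (rel_reflect_rep rel_double)
section Fold
open Literature.ModelTheory.ExponentialFields (IsSemialgebraic isSemialgebraic_setOf_eval_le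
  isSemialgebraic_setOf_eval_pos isSemialgebraic_setOf_eval_nonneg isSemialgebraic_setOf_eval_eq_zero)
open _root_.Set MvPolynomial in
open Literature.NumberTheory.Transcendental in
open Literature.NumberTheory.Transcendental.KZ (RFun cube) in
open Summit.KontsevichZagierPeriods.RootDecompQuadraticDescent.DarkPairs (rel_reflect_rep rel_double) in
/-- Auxiliary step `volume_edge0` (§19u): volume edge0. [bookkeeping] -/
private theorem volume_edge0 : MeasureTheory.volume {z : Fin 2 → ℝ | z 0 = 0} = 0 := by
  have h := volume_setOf_aeval_eq_zero (k := ℚ) (m := 2) (X 0 : MvPolynomial (Fin 2) ℚ) (by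
    rw [MvPolynomial.map_X]; exact MvPolynomial.X_ne_zero 0)
  have e : {x : Fin 2 → ℝ | aeval x (X 0 : MvPolynomial (Fin 2) ℚ) = 0} = {z | z 0 = 0} := by
    ext z; simp only [mem_setOf_eq, aeval_X]
  rw [e] at h; exact h

open _root_.Set MvPolynomial in
open Literature.NumberTheory.Transcendental in
open Literature.NumberTheory.Transcendental.KZ (RFun cube) in
open Summit.KontsevichZagierPeriods.RootDecompQuadraticDescent.DarkPairs (rel_reflect_rep rel_double) in
open Literature.ModelTheory.ExponentialFields (IsSemialgebraic isSemialgebraic_setOf_eval_le isSemialgebraic_setOf_eval_pos isSemialgebraic_setOf_eval_nonneg isSemialgebraic_setOf_eval_eq_zero) in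
/-- Auxiliary step `volume_diagG`: volume diag G. [bookkeeping] -/
private theorem volume_diagG : MeasureTheory.volume {z : Fin 2 → ℝ | z 1 - z 0 = 0} = 0 := by
  have h := volume_setOf_aeval_eq_zero (k := ℚ) (m := 2) (X 1 - X 0 : MvPolynomial (Fin 2) ℚ) (by
    intro h0
    have h1 := congr_arg (MvPolynomial.eval ![(0:ℝ), 1]) h0
    simp at h1)
  have e : {x : Fin 2 → ℝ | aeval x (X 1 - X 0 : MvPolynomial (Fin 2) ℚ) = 0} = {z | z 1 - z 0 = 0} := by
    ext z; simp only [mem_setOf_eq, map_sub, aeval_X]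
  rw [e] at h; exact h

open _root_.Set MvPolynomial in
open Literature.NumberTheory.Transcendental in
open Literature.NumberTheory.Transcendental.KZ (RFun cube) in
open Summit.KontsevichZagierPeriods.RootDecompQuadraticDescent.DarkPairs (rel_reflect_rep rel_double) in
/-- Auxiliary step `vec2_1` (§2b): vec2 1. [bookkeeping] -/
private theorem vec2_1 (a b : ℝ) : (![a, b] : Fin 2 → ℝ) 1 = b := rfl

open _root_.Set MvPolynomial in
open Literature.NumberTheory.Transcendental in
open Literature.NumberTheory.Transcendental.KZ (RFun cube) in
open Summit.KontsevichZagierPeriods.RootDecompQuadraticDescent.DarkPairs (rel_reflect_rep rel_double) in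
/-- Auxiliary step `vec2_0` (§2b): vec2 0. [bookkeeping] -/
private theorem vec2_0 (a b : ℝ) : (![a, b] : Fin 2 → ℝ) 0 = a := rfl

open _root_.Set MvPolynomial in
open Literature.NumberTheory.Transcendental in
open Literature.NumberTheory.Transcendental.KZ (RFun cube) in
open Summit.KontsevichZagierPeriods.RootDecompQuadraticDescent.DarkPairs (rel_reflect_rep rel_double) in
/-- Auxiliary step `cube2` (§0): cube2. [bookkeeping] -/
private theorem cube2 {x : Fin 2 → ℝ} (hx : x ∈ KZ.cube 2) : (0 ≤ x 0 ∧ x 0 ≤ 1) ∧ (0 ≤ x 1 ∧ x 1 ≤ 1) := ⟨hx 0, hx 1⟩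

namespace Grid

/-- remove the null edge `v = 0`. -/
theorem Bq1_P : KZ.of (Bq 1 zero_le_one).rep - KZ.of Bq1P ∈ KZ.relations := by
  refine rel_restrict_null (Bq 1 zero_le_one).rep SqP0 isSemialgebraic_SqP0 (fun _ hz => hz.1)
    (MeasureTheory.measure_mono_null (fun z hz => ?_) volume_edge0)
  obtain ⟨hzc, hzn⟩ := hz
  have hzc' : z ∈ cube 2 := hzc
  have h0 := (cube2 hzc').1
  simp only [mem_setOf_eq]
  by_contra hne
  exact hzn ⟨hzc', lt_of_le_of_ne h0.1 (Ne.symm hne)⟩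
/-- Auxiliary step `W2Tri_P`: W2 Tri P. [bookkeeping] -/
theorem W2Tri_P : KZ.of W2Tri - KZ.of W2TriP ∈ KZ.relations := by
  refine rel_restrict_null W2Tri TriPG isSemialgebraic_TriPG (fun _ hz => hz.1)
    (MeasureTheory.measure_mono_null (fun z hz => ?_) volume_edge0)
  obtain ⟨hzc, hzn⟩ := hz
  have hzc' : z ∈ TriG := hzc
  have h0 := (cube2 hzc'.1).1
  simp only [mem_setOf_eq]
  by_contra hne
  exact hzn ⟨hzc', lt_of_le_of_ne h0.1 (Ne.symm hne)⟩

set_option maxHeartbeats 800000 in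
/-- **the fibre cov** (`U = 1` copy of `BqP_cov`): `[Bq 1 | v > 0] ≡ [W₂ | 0 ≤ t ≤ v, v > 0]`. -/
theorem Bq1P_cov : KZ.of Bq1P - KZ.of W2TriP ∈ KZ.relations := by
  let Mz : (Fin 2 → ℝ) → Matrix (Fin 2) (Fin 2) ℝ := fun z => !![1, 0; z 1, z 0]
  let Φ' : (Fin 2 → ℝ) → (Fin 2 → ℝ) →L[ℝ] (Fin 2 → ℝ) := fun z =>
    LinearMap.toContinuousLinearMap (Matrix.toLin' (Mz z))
  have hΦ'ap : ∀ z w, Φ' z w = ![w 0, z 1 * w 0 + z 0 * w 1] := by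
    intro z w; funext i
    fin_cases i <;> simp [Φ', Mz, Matrix.toLin'_apply, Matrix.mulVec, dotProduct, Fin.sum_univ_two]
  have hdet : ∀ z, (Φ' z).det = z 0 := by
    intro z
    unfold ContinuousLinearMap.det
    simp [Φ', LinearMap.det_toLin', Mz, Matrix.det_fin_two]
  have hdom : W2TriP.domain = Fib '' Bq1P.domain := by
    simp only [W2TriP, Bq1P, KZ.IntegralRep.domain_restrict]
    ext w
    constructor
    · rintro ⟨⟨hwc, hle⟩, hpos⟩
      have h0 := (cube2 hwc).1
      have h1 := (cube2 hwc).2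
      have hle' : w 1 - w 0 ≤ 0 := hle
      have hpos' : 0 < w 0 := hpos
      refine ⟨![w 0, w 1 / w 0], ⟨?_, ?_⟩, ?_⟩
      · intro i
        fin_cases i
        · exact h0
        · show 0 ≤ w 1 / w 0 ∧ w 1 / w 0 ≤ 1
          exact ⟨div_nonneg h1.1 h0.1, by rw [div_le_one hpos']; linarith⟩
      · show (0:ℝ) < w 0
        exact hpos'
      · funext i
        fin_cases i
        · rfl
        · show w 0 * (w 1 / w 0) = w 1
          field_simp
    · rintro ⟨z, ⟨hzc, hpos⟩, rfl⟩
      have h0 := (cube2 hzc).1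
      have h1 := (cube2 hzc).2
      have hpos' : 0 < z 0 := hpos
      refine ⟨⟨?_, ?_⟩, ?_⟩
      · intro i
        fin_cases i
        · exact h0
        · show 0 ≤ z 0 * z 1 ∧ z 0 * z 1 ≤ 1
          exact ⟨mul_nonneg h0.1 h1.1, by nlinarith⟩
      · show z 0 * z 1 - z 0 ≤ 0
        nlinarith
      · show (0:ℝ) < z 0
        exact hpos'
  refine KZ.changeOfVariablesRel_subset_relations ⟨2, Bq1P, W2TriP, Fib, Φ', ?_, ?_, ?_, hdom, ?_, rfl⟩
  · have hsd : IsSemialgebraic ℚ Bq1P.domain := Bq1P.isSemialgebraic_domain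
    refine (isSemialgebraicMapOn_iff_forall_holds hsd).mpr fun i => ?_
    fin_cases i
    · exact (isSemialgebraicFunOn_aeval hsd (X 0)).congr fun z _ => by
        simp only [Fib, Fin.zero_eta, Matrix.cons_val_zero, aeval_X]
    · exact (isSemialgebraicFunOn_aeval hsd (X 0 * X 1)).congr fun z _ => by
        simp only [Fib, Fin.mk_one, Matrix.cons_val_one, Matrix.head_cons, Matrix.cons_val_fin_one, map_mul,
          aeval_X]
  · intro z hz
    have hA := hasFDerivAt_apply (𝕜 := ℝ) 0 z
    have hB := hasFDerivAt_apply (𝕜 := ℝ) 1 z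
    have h01 := hA.mul hB
    have hpi : HasFDerivAt Fib (Φ' z) z := by
      rw [hasFDerivAt_pi']
      intro i
      fin_cases i
      · refine (hA.congr_fderiv ?_).congr_of_eventuallyEq (Filter.Eventually.of_forall fun y => ?_)
        · ext w
          simp [hΦ'ap]
        · simp only [Fin.zero_eta, Fib_zero]
      · refine (h01.congr_fderiv ?_).congr_of_eventuallyEq (Filter.Eventually.of_forall fun y => ?_)
        · ext w
          simp [hΦ'ap]
          ring
        · simp only [Fin.mk_one, Fib_one, Pi.mul_apply]
    exact hpi.hasFDerivWithinAt
  · intro z₁ hz₁ z₂ hz₂ heq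
    have hz₁' : z₁ ∈ SqP0 := by simpa [Bq1P, KZ.IntegralRep.domain_restrict] using hz₁
    have hpos : 0 < z₁ 0 := hz₁'.2
    have e0 : z₁ 0 = z₂ 0 := by simpa [Fib] using congrFun heq 0
    have e1 : z₁ 0 * z₁ 1 = z₂ 0 * z₂ 1 := by simpa [Fib] using congrFun heq 1
    rw [← e0] at e1
    have e1' := mul_left_cancel₀ hpos.ne' e1
    funext i
    fin_cases i
    · exact e0
    · exact e1'
  · intro z hz
    have hz' : z ∈ SqP0 := by simpa [Bq1P, KZ.IntegralRep.domain_restrict] using hz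
    have h0 := (cube2 hz'.1).1
    have h1 := (cube2 hz'.1).2
    have hpos : 0 < z 0 := hz'.2
    rw [hdet z, abs_of_pos hpos]
    simp only [Bq1P, W2TriP, W2Tri, KZ.IntegralRep.integrand_restrict, RFun.rep_integrand]
    simp only [Bq, BqDen, W2, W1Den, RFun.fn, Fib, map_add, map_sub, map_mul, aeval_C, aeval_X, eq_ratCast,
      Rat.cast_one, Rat.cast_ofNat, Rat.cast_mul, vec2_0, vec2_1, Matrix.cons_val_zero, Matrix.cons_val_one,
      Matrix.head_cons, one_mul, mul_one]
    have ha : (0:ℝ) < 1 + z 0 * z 0 := by nlinarith [mul_nonneg h0.1 h0.1]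
    have hb : (0:ℝ) < 1 + z 0 * z 0 * z 1 * z 1 := by
      nlinarith [mul_nonneg (mul_nonneg h0.1 h0.1) (mul_nonneg h1.1 h1.1)]
    have hc : (0:ℝ) < 1 + z 0 * z 1 * (z 0 * z 1) := by nlinarith [mul_self_nonneg (z 0 * z 1)]
    have hane := ha.ne'
    have hbne := hb.ne'
    have hcne := hc.ne'
    field_simp

/-- the scaling `z ↦ z/√7` and its inverse `w ↦ √7·w = 7·c7·w`. -/
def Scl (z : Fin 2 → ℝ) : Fin 2 → ℝ := ![c7 * z 0, c7 * z 1]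
/-- Auxiliary definition `Tcl`: Tcl. [bookkeeping] -/
def Tcl (w : Fin 2 → ℝ) : Fin 2 → ℝ := ![7 * (c7 * w 0), 7 * (c7 * w 1)]
/-- Auxiliary step `Scl_zero`: Scl zero. [bookkeeping] -/
theorem Scl_zero (z : Fin 2 → ℝ) : Scl z 0 = c7 * z 0 := rfl
/-- Auxiliary step `Scl_one`: Scl one. [bookkeeping] -/
theorem Scl_one (z : Fin 2 → ℝ) : Scl z 1 = c7 * z 1 := rfl
/-- Auxiliary step `Tcl_zero`: Tcl zero. [bookkeeping] -/
theorem Tcl_zero (w : Fin 2 → ℝ) : Tcl w 0 = 7 * (c7 * w 0) := rfl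
/-- Auxiliary step `Tcl_one`: Tcl one. [bookkeeping] -/
theorem Tcl_one (w : Fin 2 → ℝ) : Tcl w 1 = 7 * (c7 * w 1) := rfl
/-- Auxiliary step `Scl_Tcl`: Scl Tcl. [bookkeeping] -/
theorem Scl_Tcl (w : Fin 2 → ℝ) : Scl (Tcl w) = w := by
  funext i
  fin_cases i
  · show c7 * (7 * (c7 * w 0)) = w 0
    linear_combination (w 0) * c7_mul_self
  · show c7 * (7 * (c7 * w 1)) = w 1
    linear_combination (w 1) * c7_mul_self
/-- Auxiliary step `Tcl_Scl`: Tcl Scl. [bookkeeping] -/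
theorem Tcl_Scl (z : Fin 2 → ℝ) : Tcl (Scl z) = z := by
  funext i
  fin_cases i
  · show 7 * (c7 * (c7 * z 0)) = z 0
    linear_combination (z 0) * c7_mul_self
  · show 7 * (c7 * (c7 * z 1)) = z 1
    linear_combination (z 1) * c7_mul_self

set_option maxHeartbeats 1600000 in
/-- **the scaling cov**: `[W₂ | TriG] ≡ [2W₇ | TriB]`, `TriB = TriG/√7 = (A×A) ∩ {y ≤ x}`. -/
theorem W2Tri_Sc : KZ.of W2Tri - KZ.of W14TriB ∈ KZ.relations := by
  have hc := c7_pos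
  have hc7 := c7_mul_self
  let Mz : Matrix (Fin 2) (Fin 2) ℝ := !![c7, 0; 0, c7]
  let Φ' : (Fin 2 → ℝ) → (Fin 2 → ℝ) →L[ℝ] (Fin 2 → ℝ) := fun _ =>
    LinearMap.toContinuousLinearMap (Matrix.toLin' Mz)
  have hΦ'ap : ∀ z w, Φ' z w = ![c7 * w 0, c7 * w 1] := by
    intro z w; funext i
    fin_cases i <;> simp [Φ', Mz, Matrix.toLin'_apply, Matrix.mulVec, dotProduct, Fin.sum_univ_two]
  have hdet : ∀ z, (Φ' z).det = c7 * c7 := by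
    intro z
    unfold ContinuousLinearMap.det
    simp [Φ', LinearMap.det_toLin', Mz, Matrix.det_fin_two]
  have hdetpos : (0:ℝ) < c7 * c7 := by positivity
  have hdom : W14TriB.domain = Scl '' W2Tri.domain := by
    simp only [W14TriB, W2Tri, KZ.IntegralRep.domain_restrict]
    ext w
    constructor
    · rintro ⟨⟨⟨hwc, hxx⟩, hyy⟩, hd⟩
      have h0 := (cube2 hwc).1
      have h1 := (cube2 hwc).2
      have hxx' : 7 * (w 0 * w 0) ≤ 1 := hxx
      have hyy' : 7 * (w 1 * w 1) ≤ 1 := hyy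
      have hd' : w 1 - w 0 ≤ 0 := hd
      refine ⟨Tcl w, ⟨?_, ?_⟩, Scl_Tcl w⟩
      · intro i
        fin_cases i
        · show 0 ≤ 7 * (c7 * w 0) ∧ 7 * (c7 * w 0) ≤ 1
          exact ⟨by nlinarith [mul_nonneg hc.le h0.1], seven_c7_le h0.1 hxx'⟩
        · show 0 ≤ 7 * (c7 * w 1) ∧ 7 * (c7 * w 1) ≤ 1
          exact ⟨by nlinarith [mul_nonneg hc.le h1.1], seven_c7_le h1.1 hyy'⟩
      · show Tcl w 1 - Tcl w 0 ≤ 0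
        rw [Tcl_zero, Tcl_one]; nlinarith
    · rintro ⟨z, ⟨hzc, hd⟩, rfl⟩
      have h0 := (cube2 hzc).1
      have h1 := (cube2 hzc).2
      have hd' : z 1 - z 0 ≤ 0 := hd
      refine ⟨⟨⟨?_, ?_⟩, ?_⟩, ?_⟩
      · intro i
        fin_cases i
        · show 0 ≤ c7 * z 0 ∧ c7 * z 0 ≤ 1
          exact ⟨mul_nonneg hc.le h0.1, by nlinarith [mul_le_mul c7_le_one h0.2 h0.1 zero_le_one]⟩
        · show 0 ≤ c7 * z 1 ∧ c7 * z 1 ≤ 1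
          exact ⟨mul_nonneg hc.le h1.1, by nlinarith [mul_le_mul c7_le_one h1.2 h1.1 zero_le_one]⟩
      · show 7 * (Scl z 0 * Scl z 0) ≤ 1
        rw [Scl_zero, c7_sq]; nlinarith
      · show 7 * (Scl z 1 * Scl z 1) ≤ 1
        rw [Scl_one, c7_sq]; nlinarith
      · show Scl z 1 - Scl z 0 ≤ 0
        rw [Scl_zero, Scl_one]; nlinarith
  refine KZ.changeOfVariablesRel_subset_relations ⟨2, W2Tri, W14TriB, Scl, Φ', ?_, ?_, ?_, hdom, ?_, rfl⟩
  · have hsd : IsSemialgebraic ℚ W2Tri.domain := W2Tri.isSemialgebraic_domain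
    have h7 : ∀ x ∈ W2Tri.domain, 0 < aeval x (C 7 : MvPolynomial (Fin 2) ℚ) := by
      intro x _
      simp only [aeval_C, eq_ratCast, Rat.cast_ofNat]
      norm_num
    refine (isSemialgebraicMapOn_iff_forall_holds hsd).mpr fun i => ?_
    fin_cases i
    · refine (isSemialgebraicFunOn_add_div_sqrt hsd 0 (X 0) (C 7) h7).congr fun z _ => ?_
      simp only [Fin.zero_eta, Scl_zero, map_zero, aeval_C, aeval_X, eq_ratCast, Rat.cast_ofNat, zero_add]
      rw [c7_div]
    · refine (isSemialgebraicFunOn_add_div_sqrt hsd 0 (X 1) (C 7) h7).congr fun z _ => ?_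
      simp only [Fin.mk_one, Scl_one, map_zero, aeval_C, aeval_X, eq_ratCast, Rat.cast_ofNat, zero_add]
      rw [c7_div]
  · intro z hz
    have hA := hasFDerivAt_apply (𝕜 := ℝ) 0 z
    have hB := hasFDerivAt_apply (𝕜 := ℝ) 1 z
    have hA' := hA.const_mul c7
    have hB' := hB.const_mul c7
    have hpi : HasFDerivAt Scl (Φ' z) z := by
      rw [hasFDerivAt_pi']
      intro i
      fin_cases i
      · refine (hA'.congr_fderiv ?_).congr_of_eventuallyEq (Filter.Eventually.of_forall fun y => ?_)
        · ext w
          simp [hΦ'ap]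
        · simp only [Fin.zero_eta, Scl_zero]
      · refine (hB'.congr_fderiv ?_).congr_of_eventuallyEq (Filter.Eventually.of_forall fun y => ?_)
        · ext w
          simp [hΦ'ap]
        · simp only [Fin.mk_one, Scl_one]
    exact hpi.hasFDerivWithinAt
  · intro z₁ hz₁ z₂ hz₂ heq
    have h := congr_arg Tcl heq
    rwa [Tcl_Scl, Tcl_Scl] at h
  · intro z hz
    rw [hdet z, abs_of_pos hdetpos]
    simp only [W14TriB, W2Tri, KZ.IntegralRep.integrand_restrict, RFun.rep_integrand]
    simp only [W2, W1Den, W14, W7Den, RFun.fn, Scl, map_add, map_sub, map_mul, aeval_C, aeval_X, eq_ratCast,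
      Rat.cast_one, Rat.cast_ofNat, vec2_0, vec2_1, Matrix.cons_val_zero, Matrix.cons_val_one, Matrix.head_cons]
    have e0 : (1:ℝ) + 7 * (c7 * z 0) * (c7 * z 0) = 1 + z 0 * z 0 := by linear_combination (z 0 * z 0) * hc7
    have e1 : (1:ℝ) + 7 * (c7 * z 1) * (c7 * z 1) = 1 + z 1 * z 1 := by linear_combination (z 1 * z 1) * hc7
    have e2 : (14:ℝ) * (c7 * c7) = 2 := by linear_combination 2 * hc7
    rw [e0, e1, div_mul_eq_mul_div, e2]

/-- `[2W₇ | TriB] ≡ 2•[W₇ | TriB]`, `[W₇|A×A] ≡ [W₇|TriB] + [W₇|TriUpB]`, `[W₇|TriUpB] ≡ [W₇|TriB]`. -/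
theorem W14TriB_twice : KZ.of W14TriB - KZ.of W7TriB - KZ.of W7TriB ∈ KZ.relations :=
  KZ.integrandAddRel_subset_relations ⟨2, W14TriB, W7TriB, W7TriB, rfl, rfl, fun z _ => by
    simp only [W14TriB, W7TriB, KZ.IntegralRep.integrand_restrict, RFun.rep_integrand, Pi.add_apply]
    simp only [W14, W7, RFun.fn, aeval_C, eq_ratCast, Rat.cast_ofNat]
    ring, rfl⟩
/-- Auxiliary step `Bsq_diag`: Bsq diag. [bookkeeping] -/
theorem Bsq_diag : KZ.of W7Bsq - KZ.of W7TriB - KZ.of W7TriUpB ∈ KZ.relations :=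
  rel_cut W7Bsq W7TriB W7TriUpB (fun z => z 1 - z 0) 0 rfl rfl volume_diagG (fun _ _ => rfl) (fun _ _ => rfl)
/-- Auxiliary step `TriUpB_TriB`: Tri Up B Tri B. [bookkeeping] -/
theorem TriUpB_TriB : KZ.of W7TriUpB - KZ.of W7TriB ∈ KZ.relations := by
  refine W7_swap isSemialgebraic_TriUpB isSemialgebraic_TriB (fun _ hz => hz.1.1.1) (fun _ hz => hz.1.1.1)
    (fun z hz => ?_) (fun w hw => ?_)
  · obtain ⟨⟨⟨hcu, hxx⟩, hyy⟩, hd⟩ := hz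
    have hd' : 0 ≤ z 1 - z 0 := hd
    refine ⟨⟨⟨Sw_cube hcu, ?_⟩, ?_⟩, ?_⟩
    · show 7 * (Sw z 0 * Sw z 0) ≤ 1; rw [Sw_zero]; exact hyy
    · show 7 * (Sw z 1 * Sw z 1) ≤ 1; rw [Sw_one]; exact hxx
    · show Sw z 1 - Sw z 0 ≤ 0
      rw [Sw_zero, Sw_one]; linarith
  · obtain ⟨⟨⟨hcu, hxx⟩, hyy⟩, hd⟩ := hw
    have hd' : w 1 - w 0 ≤ 0 := hd
    refine ⟨⟨⟨Sw_cube hcu, ?_⟩, ?_⟩, ?_⟩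
    · show 7 * (Sw w 0 * Sw w 0) ≤ 1; rw [Sw_zero]; exact hyy
    · show 7 * (Sw w 1 * Sw w 1) ≤ 1; rw [Sw_one]; exact hxx
    · show 0 ≤ Sw w 1 - Sw w 0
      rw [Sw_zero, Sw_one]; linarith

/-- **`[B11] ≡ [W₇ | A × A]`** (`(π/4)²`). -/
theorem B11_Bsq : KZ.of B11.rep - KZ.of W7Bsq ∈ KZ.relations := by
  have hq : KZ.of (Bq 1 zero_le_one).rep - KZ.of B11.rep ∈ KZ.relations := Bq_Bbox 1 zero_le_one
  have h := sub_mem (sub_mem (add_mem (add_mem (sub_mem (add_mem (add_mem (neg_mem hq) Bq1_P) Bq1P_cov)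
    W2Tri_P) W2Tri_Sc) W14TriB_twice) Bsq_diag) TriUpB_TriB
  have e : KZ.of B11.rep - KZ.of W7Bsq
      = -(KZ.of (Bq 1 zero_le_one).rep - KZ.of B11.rep) + (KZ.of (Bq 1 zero_le_one).rep - KZ.of Bq1P)
        + (KZ.of Bq1P - KZ.of W2TriP) - (KZ.of W2Tri - KZ.of W2TriP) + (KZ.of W2Tri - KZ.of W14TriB)
        + (KZ.of W14TriB - KZ.of W7TriB - KZ.of W7TriB) - (KZ.of W7Bsq - KZ.of W7TriB - KZ.of W7TriUpB)
        - (KZ.of W7TriUpB - KZ.of W7TriB) := by abel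
  rw [e]; exact h

end Grid

end Fold
end Summit.KontsevichZagierPeriods.RootDecompQuadraticDescent.Pair18Homotopy
end
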